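import Summits.HodgeConjecture.CorCM.Census.CentralSquaresOrderFourFrame
import Summits.HodgeConjecture.CorCM.Census.CentralSquaresChosenCoverThree

/-!
# The square-central class, XXXI: THE ORDER-`4` FRAME LAW `μ(G, c) = φ₂(G, c)`

COR-CM (cell `pub-hodgecm2`), count-neutral kernel combinatorics by the binder seat b09 (gen 46; lane SQUARE-CENTRAL CLASS, part XXXI), assembling parts XIII/XXIX
(`isLeast_card_gfaces_generate_of_chosen_cover_closure`, `exists_admissible_choice₃`), XXI (`ddist_pair_type`, `not_strict_rt_pair_type`), XV (`strict_triple_tie_corner`,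
`nearest_shapeA/B`), V/XVI (`unique_frame`, `bpot_frame`, frame exchange), XXVI (`dev_compl_oflipCM_pair_type`) and XXX (`residual_closure_order_four`) BY NAME.
Theorems only: no definition, no `decide`, no certificate, no named fact, no `sorry`.  HONEST FRAMING: `HC_CM` is NOT proved, here or anywhere in the tree;
nothing here is a period or a headline.

* §1 `strict_triple_rt`: a strict lowering triple `(Q₁; s, s')` at `X` transports to `(g·Q₁; s·g⁻¹, s'·g⁻¹)` at `X·g⁻¹`.
* §2 **`isLeast_card_gfaces_generate_order_four`** — THE ORDER-`4` FRAME LAW.  `G` a `2`-group, `c` a central involution `≠ 1`; the `m = 2` frame with a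
  base-involutive swap `Q` (`T₀·Q⁻¹ = T₁`, `T₁·Q⁻¹ = T₀`, place permutation preserving `𝓗`); transversals `T = {t₁, t₂} ⊆ 𝓗` and `A ⊆ 𝓗ᶜ`; the designated type
  `Φ` (`D(Φ) = T ∪ A`) with its mixed face at `k ∈ A`, `h ∈ 𝓗 ∖ T`; `g₁` stabilising `T₀` and `Φ` with `T₁·g₁⁻¹ = T̄₁`; the place relations of part XXX; and the
  two tie blocks distinct (`Φ^{(k)}·g⁻¹ ≠ Φ^{(h)}` for all `g`).  Then **`μ(G, c) = φ₂(G, c)`**: prescribe the mixed face at the block of `Φ` and the strict faces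
  toward `T₁` at the block of `Φ^{(k)}` and toward `T̄₀` at the block of `Φ^{(h)}` (part XXIX); every strict cover containing them closes the residual lattice up to
  `4` (part XXX); part XIII concludes.

## References
* [Pohlmann1968] H. Pohlmann, Algebraic cycles on abelian varieties of complex multiplication type, Ann. of Math. 88 (1968), Thm 1.
* [Milne1999] J. S. Milne, Lefschetz motives and the Tate conjecture, Compositio Math. 117 (1999), Prop. 2.1, p. 54.
-/

namespace Summit.HodgeConjecture.CorCM.Census.CentralSquares

open Finset
open scoped symmDiff
open Summit.HodgeConjecture.CorCM.Prior.AllgGroup.RfwfAllgGroup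
open Summit.HodgeConjecture.CorCM.Census.BlockParity
open Summit.HodgeConjecture.CorCM.Census.Coinvariant
open Summit.HodgeConjecture.CorCM.Census.TwistGeneration
open Summit.HodgeConjecture.CorCM.Census.BaseBlock
open Summit.HodgeConjecture.CorCM.Census.CoverClosure

noncomputable section

variable {G : Type*} [Group G] [Fintype G] [DecidableEq G] (c : G)

/-! ## §1 Transport of strict lowering triples -/

/-- **A strict lowering triple transports along a base change**: `(Q₁; s, s')` at `X` gives `(g·Q₁; s·g⁻¹, s'·g⁻¹)` at `X·g⁻¹`. [folklore] -/
theorem strict_triple_rt (hc2 : c * c = 1) (T₀ : CMF G c) (g : G) {X : CMF G c} {Q₁ s s' : G}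
    (h : bpot c T₀ X = ddist (rt c Q₁ T₀) X ∧ s ∈ (rt c Q₁ T₀).1 \ X.1 ∧ s' ∈ (rt c Q₁ T₀).1 \ X.1 ∧ s ≠ s' ∧
      (∀ Q' : G, ddist (rt c Q' T₀) (oflipCM c hc2 s X) = bpot c T₀ (oflipCM c hc2 s X) → rt c Q' T₀ = rt c Q₁ T₀) ∧
      (∀ Q' : G, ddist (rt c Q' T₀) (oflipCM c hc2 s' X) = bpot c T₀ (oflipCM c hc2 s' X) → rt c Q' T₀ = rt c Q₁ T₀) ∧
      (∀ Q' : G, ddist (rt c Q' T₀) (oflipCM c hc2 s (oflipCM c hc2 s' X)) = bpot c T₀ (oflipCM c hc2 s (oflipCM c hc2 s' X)) →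
        rt c Q' T₀ = rt c Q₁ T₀)) :
    bpot c T₀ (rt c g X) = ddist (rt c (g * Q₁) T₀) (rt c g X) ∧
      s * g⁻¹ ∈ (rt c (g * Q₁) T₀).1 \ (rt c g X).1 ∧ s' * g⁻¹ ∈ (rt c (g * Q₁) T₀).1 \ (rt c g X).1 ∧ s * g⁻¹ ≠ s' * g⁻¹ ∧
      (∀ Q' : G, ddist (rt c Q' T₀) (oflipCM c hc2 (s * g⁻¹) (rt c g X)) = bpot c T₀ (oflipCM c hc2 (s * g⁻¹) (rt c g X)) →
        rt c Q' T₀ = rt c (g * Q₁) T₀) ∧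
      (∀ Q' : G, ddist (rt c Q' T₀) (oflipCM c hc2 (s' * g⁻¹) (rt c g X)) = bpot c T₀ (oflipCM c hc2 (s' * g⁻¹) (rt c g X)) →
        rt c Q' T₀ = rt c (g * Q₁) T₀) ∧
      (∀ Q' : G, ddist (rt c Q' T₀) (oflipCM c hc2 (s * g⁻¹) (oflipCM c hc2 (s' * g⁻¹) (rt c g X))) =
          bpot c T₀ (oflipCM c hc2 (s * g⁻¹) (oflipCM c hc2 (s' * g⁻¹) (rt c g X))) → rt c Q' T₀ = rt c (g * Q₁) T₀) := by
  obtain ⟨h1, hs, hs', hss', hu1, hu2, hu3⟩ := h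
  -- transport of a uniqueness statement
  have htr : ∀ Y : CMF G c, (∀ Q' : G, ddist (rt c Q' T₀) Y = bpot c T₀ Y → rt c Q' T₀ = rt c Q₁ T₀) →
      ∀ Q' : G, ddist (rt c Q' T₀) (rt c g Y) = bpot c T₀ (rt c g Y) → rt c Q' T₀ = rt c (g * Q₁) T₀ := by
    intro Y hY Q' hQ'
    rw [bpot_rt, ← ddist_rt g⁻¹ (rt c Q' T₀) (rt c g Y), rt_inv_rt, ← rt_mul] at hQ'
    have e := hY (g⁻¹ * Q') hQ'
    have e2 : rt c Q' T₀ = rt c g (rt c (g⁻¹ * Q') T₀) := by rw [← rt_mul, mul_inv_cancel_left]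
    rw [e2, e, ← rt_mul]
  refine ⟨?_, ?_, ?_, fun e => hss' (mul_right_cancel e), ?_, ?_, ?_⟩
  · rw [bpot_rt, rt_mul, ddist_rt, h1]
  · rw [rt_mul, mem_sdiff_rt_iff, inv_mul_cancel_right]; exact hs
  · rw [rt_mul, mem_sdiff_rt_iff, inv_mul_cancel_right]; exact hs'
  · rw [← rt_oflipCM]; exact htr _ hu1
  · rw [← rt_oflipCM]; exact htr _ hu2
  · rw [← rt_oflipCM, ← rt_oflipCM]; exact htr _ hu3

/-! ## §2 The order-`4` frame law -/

section Frame

variable (hc2 : c * c = 1) (hcen : ∀ x : G, x * c = c * x) (T₀ T₁ : CMF G c)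
variable (hbase : ∀ Q : G, rt c Q T₀ = T₀ ∨ rt c Q T₀ = rt c c T₀ ∨ rt c Q T₀ = T₁ ∨ rt c Q T₀ = rt c c T₁)
variable (m : ℕ) (hn : T₀.1.card = 4 * m) (hH : (T₀.1 \ T₁.1).card = 2 * m)

include hcen hbase hn hH in
/-- **THE ORDER-`4` FRAME LAW `μ(G, c) = φ₂(G, c)`** (see the file header for the hypotheses). [folklore] -/
theorem isLeast_card_gfaces_generate_order_four (hG : IsPGroup 2 G) (hc1 : c ≠ 1) (hm : m = 2)
    (Q : G) (hQ : rt c Q T₀ = T₁) (hQ₁ : rt c Q T₁ = T₀)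
    (hσH : ∀ t ∈ T₀.1, ∀ t' ∈ T₀.1, (t' = t * Q ∨ t' = c * (t * Q)) → (t ∈ T₀.1 \ T₁.1 ↔ t' ∈ T₀.1 \ T₁.1))
    (T A : Finset G) (hTH : T ⊆ T₀.1 \ T₁.1) (hA : A ⊆ T₀.1 ∩ T₁.1)
    (hT : ∀ t ∈ T₀.1 \ T₁.1, ∀ t' ∈ T₀.1, (t' = t * Q ∨ t' = c * (t * Q)) → (t ∈ T ↔ t' ∉ T))
    (hAtr : ∀ t ∈ T₀.1 ∩ T₁.1, ∀ t' ∈ T₀.1, (t' = t * Q ∨ t' = c * (t * Q)) → (t ∈ A ↔ t' ∉ A))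
    {t₁ t₂ : G} (hTe : T = {t₁, t₂}) (ht₁₂ : t₁ ≠ t₂)
    (Φ : CMF G c) (hΦ : T₀.1 \ Φ.1 = T ∪ A)
    {k k'' : G} (hAe : A = {k, k''}) (hkk'' : k ≠ k'')
    {h h'' : G} (hHe : (T₀.1 \ T₁.1) \ T = {h, h''}) (hhh'' : h ≠ h'')
    (g₁ : G) (hg₀ : rt c g₁ T₀ = T₀) (hg₁ : rt c g₁ T₁ = rt c c T₁) (hgΦ : rt c g₁ Φ = Φ)
    {κ₂ : G} (hAce : (T₀.1 ∩ T₁.1) \ A = {h * g₁⁻¹, κ₂}) (hκ₁₂ : h * g₁⁻¹ ≠ κ₂)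
    {a₁ a₂ : G} (ha₁A : a₁ ∈ A) (ha₂A : a₂ ∈ A) (ha₁₂ : a₁ ≠ a₂)
    (hζh : h * g₁⁻¹ * g₁⁻¹ = h'' ∨ h * g₁⁻¹ * g₁⁻¹ = c * h'')
    (hζκ : h * g₁⁻¹ * g₁⁻¹ * g₁⁻¹ = κ₂ ∨ h * g₁⁻¹ * g₁⁻¹ * g₁⁻¹ = c * κ₂)
    (hσh : h * Q⁻¹ = t₁ ∨ h * Q⁻¹ = c * t₁) (hσh'' : h'' * Q⁻¹ = t₂ ∨ h'' * Q⁻¹ = c * t₂)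
    (hσκ₁ : h * g₁⁻¹ * Q⁻¹ = a₁ ∨ h * g₁⁻¹ * Q⁻¹ = c * a₁) (hσκ₂ : κ₂ * Q⁻¹ = a₂ ∨ κ₂ * Q⁻¹ = c * a₂)
    (hB : ∀ g : G, rt c g (oflipCM c hc2 k Φ) ≠ oflipCM c hc2 h Φ) :
    IsLeast {n : ℕ | ∃ S : Finset (CMF G c →₀ ℤ), (↑S ⊆ gfaceSet G c hc2) ∧ S.card = n ∧
      hodgeSpan c hc2 ≤ Submodule.span ℤ (pairSet c) ⊔ Submodule.span ℤ (translates c S)} (fibreTwo c hc2) := by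
  have hm2 : 2 ≤ m := by omega
  have hcinv : c⁻¹ = c := inv_eq_of_mul_eq_one_right hc2
  -- the elements
  have hk : k ∈ A := by rw [hAe]; exact mem_insert_self _ _
  have hk'' : k'' ∈ A := by rw [hAe]; exact mem_insert_of_mem (mem_singleton_self _)
  have hk0 : k ∈ T₀.1 := (mem_inter.mp (hA hk)).1
  have hk1 : k ∈ T₁.1 := (mem_inter.mp (hA hk)).2
  have hk''0 : k'' ∈ T₀.1 := (mem_inter.mp (hA hk'')).1
  have hk''1 : k'' ∈ T₁.1 := (mem_inter.mp (hA hk'')).2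
  have hkΦ : k ∉ Φ.1 := by
    have h0 : k ∈ T₀.1 \ Φ.1 := by rw [hΦ]; exact mem_union_right _ hk
    exact (mem_sdiff.mp h0).2
  have hh : h ∈ (T₀.1 \ T₁.1) \ T := by rw [hHe]; exact mem_insert_self _ _
  have hh'' : h'' ∈ (T₀.1 \ T₁.1) \ T := by rw [hHe]; exact mem_insert_of_mem (mem_singleton_self _)
  have hh0 : h ∈ T₀.1 := (mem_sdiff.mp (mem_sdiff.mp hh).1).1
  have hh1 : h ∉ T₁.1 := (mem_sdiff.mp (mem_sdiff.mp hh).1).2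
  have hh''0 : h'' ∈ T₀.1 := (mem_sdiff.mp (mem_sdiff.mp hh'').1).1
  have hh''1 : h'' ∉ T₁.1 := (mem_sdiff.mp (mem_sdiff.mp hh'').1).2
  have hch1 : c * h ∈ T₁.1 := by by_contra hc'; exact hh1 ((T₁.2 h).mpr hc')
  have hch''1 : c * h'' ∈ T₁.1 := by by_contra hc'; exact hh''1 ((T₁.2 h'').mpr hc')
  have hch0 : c * h ∉ T₀.1 := (T₀.2 h).mp hh0
  have hch''0 : c * h'' ∉ T₀.1 := (T₀.2 h'').mp hh''0
  have hhΦ : h ∈ Φ.1 := by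
    by_contra hc'
    have h0 : h ∈ T₀.1 \ Φ.1 := mem_sdiff.mpr ⟨hh0, hc'⟩
    rw [hΦ, mem_union] at h0
    rcases h0 with hT' | hAm
    · exact (mem_sdiff.mp hh).2 hT'
    · exact hh1 (mem_inter.mp (hA hAm)).2
  have hchΦ : c * h ∉ Φ.1 := (Φ.2 h).mp hhΦ
  have hκ₁ : h * g₁⁻¹ ∈ (T₀.1 ∩ T₁.1) \ A := by rw [hAce]; exact mem_insert_self _ _
  have hκ₂ : κ₂ ∈ (T₀.1 ∩ T₁.1) \ A := by rw [hAce]; exact mem_insert_of_mem (mem_singleton_self _)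
  have hκ₁0 : h * g₁⁻¹ ∈ T₀.1 := (mem_inter.mp (mem_sdiff.mp hκ₁).1).1
  have hκ₁1 : h * g₁⁻¹ ∈ T₁.1 := (mem_inter.mp (mem_sdiff.mp hκ₁).1).2
  have hκ₂0 : κ₂ ∈ T₀.1 := (mem_inter.mp (mem_sdiff.mp hκ₂).1).1
  have hκ₂1 : κ₂ ∈ T₁.1 := (mem_inter.mp (mem_sdiff.mp hκ₂).1).2
  have hkch : k ≠ c * h := fun e => hch0 (e ▸ hk0)
  have hkch'' : k ≠ c * h'' := fun e => hch''0 (e ▸ hk0)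
  have hchch'' : c * h ≠ c * h'' := fun e => hhh'' (mul_left_cancel e)
  have hTm2 : T.card = 2 := by rw [hTe, card_pair ht₁₂]
  have hAm2 : A.card = 2 := by rw [hAe, card_pair hkk'']
  have hHc : (T₀.1 ∩ T₁.1).card = 2 * m := by
    have h0 := card_sdiff_add_card_inter T₀.1 T₁.1; rw [hn, hH] at h0; omega
  -- the exchanged frame `(T₁; T₀)`
  have hbase₁ := base_cases_exchange c hbase hQ
  have hn₁ : T₁.1.card = 4 * m := card_frame c hc2 T₀ T₁ m hn
  have hH₁ : (T₁.1 \ T₀.1).card = 2 * m := by rw [card_sdiff_frame c hc2 T₀ T₁, hH]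
  have hbf : ∀ Ψ : CMF G c, bpot c T₁ Ψ = bpot c T₀ Ψ := fun Ψ => by rw [← hQ]; exact bpot_frame c T₀ Q Ψ
  have hQinv : rt c Q⁻¹ T₀ = T₁ := by
    have e := rt_inv_rt c Q T₁; rwa [hQ₁] at e
  -- `D_{T₁}` of the designated type and of the corner `Φ^{(k)}`
  have hD1 : T₁.1 \ Φ.1 = {k, k''} ∪ {c * h, c * h''} := by
    rw [sdiff_T₁_pair_type c hc2 T₀ T₁ T A hTH hA Φ hΦ, hAe, hHe, image_insert, image_singleton]
  have hX : T₁.1 \ (oflipCM c hc2 k Φ).1 = {k'', c * h, c * h''} := by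
    rw [dev_oflip c hc2 hk1 hkΦ, hD1]
    ext x
    simp only [mem_erase, mem_union, mem_insert, mem_singleton]
    constructor
    · rintro ⟨hxk, (rfl | rfl) | rfl | rfl⟩
      · exact absurd rfl hxk
      · exact Or.inl rfl
      · exact Or.inr (Or.inl rfl)
      · exact Or.inr (Or.inr rfl)
    · rintro (rfl | rfl | rfl)
      · exact ⟨hkk''.symm, Or.inl (Or.inr rfl)⟩
      · exact ⟨hkch.symm, Or.inr (Or.inl rfl)⟩
      · exact ⟨hkch''.symm, Or.inr (Or.inr rfl)⟩
  -- (B₀) the designated block: no strict triple, the mixed face lowers toward `T₁`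
  obtain ⟨hb4, hall⟩ := ddist_pair_type c hc2 hcen T₀ T₁ hbase m hn hH hm T A hTH hTm2 hA hAm2 Φ hΦ
  have hd1 : ddist T₁ Φ = 4 := by have e := hall Q; rwa [hQ] at e
  obtain ⟨g, hg⟩ : ∃ g : G, rt c g Φ = (blk c Φ).out := exists_rt_eq_of_blk_eq c (blk_out c (blk c Φ)).symm
  have hlow₀ : bpot c T₀ (blk c Φ).out = ddist (rt c (g * Q) T₀) (blk c Φ).out ∧
      k * g⁻¹ ∈ (rt c (g * Q) T₀).1 \ ((blk c Φ).out).1 ∧ (c * h) * g⁻¹ ∈ (rt c (g * Q) T₀).1 \ ((blk c Φ).out).1 ∧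
      k * g⁻¹ ≠ (c * h) * g⁻¹ := by
    rw [← hg, bpot_rt, rt_mul, hQ, ddist_rt, hb4, hd1, mem_sdiff_rt_iff, mem_sdiff_rt_iff, inv_mul_cancel_right, inv_mul_cancel_right]
    exact ⟨rfl, mem_sdiff.mpr ⟨hk1, hkΦ⟩, mem_sdiff.mpr ⟨hch1, hchΦ⟩, fun e => hkch (mul_right_cancel e)⟩
  have h₀ns := not_strict_rt_pair_type c hc2 hcen T₀ T₁ hbase m hn hH hm T A hTH hTm2 hA hAm2 Φ hΦ hQ g
  rw [hg] at h₀ns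
  -- (B₁) the block of `Φ^{(k)}`: the strict face toward `T₁` with places `h, h''`
  have hbpk₁ : bpot c T₁ (oflipCM c hc2 k Φ) = 3 :=
    (nearest_shapeB c hc2 hcen T₁ T₀ hbase₁ m hn₁ hH₁ hm2 (mem_inter.mpr ⟨hk''1, hk''0⟩) (mem_sdiff.mpr ⟨hch1, hch0⟩)
      (mem_sdiff.mpr ⟨hch''1, hch''0⟩) hchch'' _ hX).1
  have hbpk : bpot c T₀ (oflipCM c hc2 k Φ) = 3 := by rw [← hbf]; exact hbpk₁
  have hS₁' := strict_triple_tie_corner c hc2 hcen T₁ T₀ hbase₁ m hn₁ hH₁ hm2 hk''1 hch1 hch''1 hchch'' (iff_of_true hk''0 hch0)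
    (iff_of_true hk''0 hch''0) _ hX hbpk₁
  -- in `T₀`-frame terms: the strict triple `(Q⁻¹; c·h, c·h'')` at `Φ^{(k)}`
  have hS₁ : bpot c T₀ (oflipCM c hc2 k Φ) = ddist (rt c Q⁻¹ T₀) (oflipCM c hc2 k Φ) ∧
      c * h ∈ (rt c Q⁻¹ T₀).1 \ (oflipCM c hc2 k Φ).1 ∧ c * h'' ∈ (rt c Q⁻¹ T₀).1 \ (oflipCM c hc2 k Φ).1 ∧ c * h ≠ c * h'' ∧
      (∀ Q' : G, ddist (rt c Q' T₀) (oflipCM c hc2 (c * h) (oflipCM c hc2 k Φ)) = bpot c T₀ (oflipCM c hc2 (c * h) (oflipCM c hc2 k Φ)) →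
        rt c Q' T₀ = rt c Q⁻¹ T₀) ∧
      (∀ Q' : G, ddist (rt c Q' T₀) (oflipCM c hc2 (c * h'') (oflipCM c hc2 k Φ)) = bpot c T₀ (oflipCM c hc2 (c * h'') (oflipCM c hc2 k Φ)) →
        rt c Q' T₀ = rt c Q⁻¹ T₀) ∧
      (∀ Q' : G, ddist (rt c Q' T₀) (oflipCM c hc2 (c * h) (oflipCM c hc2 (c * h'') (oflipCM c hc2 k Φ))) =
          bpot c T₀ (oflipCM c hc2 (c * h) (oflipCM c hc2 (c * h'') (oflipCM c hc2 k Φ))) → rt c Q' T₀ = rt c Q⁻¹ T₀) := by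
    obtain ⟨e1, hs, hs', hss', hu1, hu2, hu3⟩ := hS₁'
    rw [rt_one] at e1 hs hs'
    have htr : ∀ Y : CMF G c, (∀ Q' : G, ddist (rt c Q' T₁) Y = bpot c T₁ Y → rt c Q' T₁ = rt c 1 T₁) →
        ∀ Q' : G, ddist (rt c Q' T₀) Y = bpot c T₀ Y → rt c Q' T₀ = rt c Q⁻¹ T₀ := by
      intro Y hY
      have e := unique_frame c T₁ Q hY
      rw [hQ₁, one_mul] at e
      exact e
    refine ⟨?_, ?_, ?_, hss', htr _ hu1, htr _ hu2, htr _ hu3⟩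
    · rw [hQinv, ← hbf]; exact e1
    · rw [hQinv]; exact hs
    · rw [hQinv]; exact hs'
  obtain ⟨g', hg'⟩ : ∃ g' : G, rt c g' (oflipCM c hc2 k Φ) = (blk c (oflipCM c hc2 k Φ)).out :=
    exists_rt_eq_of_blk_eq c (blk_out c (blk c (oflipCM c hc2 k Φ))).symm
  have hτ₁ := strict_triple_rt c hc2 T₀ g' hS₁
  rw [hg'] at hτ₁
  -- (B₂) the block of `Φ^{(h)}`: the strict face toward `T̄₀` with places `κ₁, κ₂`, through the complement (shape A toward `T₀`)
  have hXc := dev_compl_oflipCM_pair_type c hc2 hcen T₀ T₁ T A hTH hA Φ hΦ hHe hhh'' hAce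
  have hbph : bpot c T₀ (rt c c (oflipCM c hc2 h Φ)) = 3 :=
    (nearest_shapeA c hc2 hcen T₀ T₁ hbase m hn hH hm2 (mem_sdiff.mp hh'').1 (mem_sdiff.mp hκ₁).1 (mem_sdiff.mp hκ₂).1 hκ₁₂ _ hXc).1
  have hS₂'' := strict_triple_tie_corner c hc2 hcen T₀ T₁ hbase m hn hH hm2 hh''0 hκ₁0 hκ₂0 hκ₁₂ (iff_of_false hh''1 (not_not.mpr hκ₁1))
    (iff_of_false hh''1 (not_not.mpr hκ₂1)) _ hXc hbph
  have hS₂' := strict_triple_rt c hc2 T₀ c hS₂''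
  rw [← rt_mul, hc2, rt_one, mul_one] at hS₂'
  obtain ⟨g'', hg''⟩ : ∃ g'' : G, rt c g'' (oflipCM c hc2 h Φ) = (blk c (oflipCM c hc2 h Φ)).out :=
    exists_rt_eq_of_blk_eq c (blk_out c (blk c (oflipCM c hc2 h Φ))).symm
  have hτ₂ := strict_triple_rt c hc2 T₀ g'' hS₂'
  rw [hg''] at hτ₂
  -- the three blocks are distinct
  have hbph' : bpot c T₀ (oflipCM c hc2 h Φ) = 3 := by
    have e := bpot_rt c T₀ c (rt c c (oflipCM c hc2 h Φ))
    rw [← rt_mul, hc2, rt_one] at e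
    rw [e]; exact hbph
  have h10 : blk c (oflipCM c hc2 k Φ) ≠ blk c Φ := by
    intro e
    obtain ⟨x, hx⟩ := exists_rt_eq_of_blk_eq c e
    have e2 := bpot_rt c T₀ x (oflipCM c hc2 k Φ)
    rw [hx, hb4, hbpk] at e2
    omega
  have h20 : blk c (oflipCM c hc2 h Φ) ≠ blk c Φ := by
    intro e
    obtain ⟨x, hx⟩ := exists_rt_eq_of_blk_eq c e
    have e2 := bpot_rt c T₀ x (oflipCM c hc2 h Φ)
    rw [hx, hb4, hbph'] at e2
    omega
  have h21 : blk c (oflipCM c hc2 h Φ) ≠ blk c (oflipCM c hc2 k Φ) := by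
    intro e
    obtain ⟨x, hx⟩ := exists_rt_eq_of_blk_eq c e.symm
    exact hB x hx
  -- the admissible choice with the three prescriptions
  obtain ⟨τ, hτ₀, hτB₁, hτB₂, hτlow, hτstr⟩ := exists_admissible_choice₃ c T₀ hc2 (blk c Φ) (blk c (oflipCM c hc2 k Φ))
    (blk c (oflipCM c hc2 h Φ)) (g * Q, k * g⁻¹, (c * h) * g⁻¹) (g' * Q⁻¹, c * h * g'⁻¹, c * h'' * g'⁻¹)
    (g'' * c, h * g₁⁻¹ * c⁻¹ * g''⁻¹, κ₂ * c⁻¹ * g''⁻¹) h10 h20 h21 hlow₀ h₀ns hτ₁ hτ₂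
  refine isLeast_card_gfaces_generate_of_chosen_cover_closure c T₀ hG hc2 hc1 hcen 2 τ hτlow hτstr fun S hS hmem hlow => ?_
  -- the lattice of a strict cover containing the chosen faces
  have hP : ∀ Ψ : CMF G c, pair c Ψ ∈ Submodule.span ℤ (pairSet c) ⊔ Submodule.span ℤ (translates c S) :=
    fun Ψ => Submodule.mem_sup_left (Submodule.subset_span (pair_mem_pairSet c Ψ))
  have hLrt : ∀ (Q' : G) (y : CMF G c →₀ ℤ), y ∈ Submodule.span ℤ (pairSet c) ⊔ Submodule.span ℤ (translates c S) →
      Finsupp.mapDomain (rt c Q') y ∈ Submodule.span ℤ (pairSet c) ⊔ Submodule.span ℤ (translates c S) :=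
    fun Q' y hy => mapDomain_rt_mem_psp c hcen Q' S hy
  have hcover : ∀ Ψ : CMF G c, 2 ≤ bpot c T₀ Ψ → ∃ Q₃ x x' : G, bpot c T₀ Ψ = ddist (rt c Q₃ T₀) Ψ ∧
      x ∈ (rt c Q₃ T₀).1 \ Ψ.1 ∧ x' ∈ (rt c Q₃ T₀).1 \ Ψ.1 ∧ x ≠ x' ∧
      gface c hc2 Ψ x x' ∈ Submodule.span ℤ (pairSet c) ⊔ Submodule.span ℤ (translates c S) ∧
      ((∃ Q₁ y y' : G, bpot c T₀ Ψ = ddist (rt c Q₁ T₀) Ψ ∧ y ∈ (rt c Q₁ T₀).1 \ Ψ.1 ∧ y' ∈ (rt c Q₁ T₀).1 \ Ψ.1 ∧ y ≠ y' ∧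
          (∀ Q' : G, ddist (rt c Q' T₀) (oflipCM c hc2 y Ψ) = bpot c T₀ (oflipCM c hc2 y Ψ) → rt c Q' T₀ = rt c Q₁ T₀) ∧
          (∀ Q' : G, ddist (rt c Q' T₀) (oflipCM c hc2 y' Ψ) = bpot c T₀ (oflipCM c hc2 y' Ψ) → rt c Q' T₀ = rt c Q₁ T₀) ∧
          (∀ Q' : G, ddist (rt c Q' T₀) (oflipCM c hc2 y (oflipCM c hc2 y' Ψ)) = bpot c T₀ (oflipCM c hc2 y (oflipCM c hc2 y' Ψ)) →
            rt c Q' T₀ = rt c Q₁ T₀)) →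
        (∀ Q' : G, ddist (rt c Q' T₀) (oflipCM c hc2 x Ψ) = bpot c T₀ (oflipCM c hc2 x Ψ) → rt c Q' T₀ = rt c Q₃ T₀) ∧
        (∀ Q' : G, ddist (rt c Q' T₀) (oflipCM c hc2 x' Ψ) = bpot c T₀ (oflipCM c hc2 x' Ψ) → rt c Q' T₀ = rt c Q₃ T₀) ∧
        (∀ Q' : G, ddist (rt c Q' T₀) (oflipCM c hc2 x (oflipCM c hc2 x' Ψ)) = bpot c T₀ (oflipCM c hc2 x (oflipCM c hc2 x' Ψ)) →
          rt c Q' T₀ = rt c Q₃ T₀)) := by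
    intro Ψ h2
    obtain ⟨Q₃, x, x', hQ₃, hx, hx', hxx', hxmem, hstr⟩ := hlow Ψ h2
    exact ⟨Q₃, x, x', hQ₃, hx, hx', hxx', Submodule.mem_sup_right hxmem, hstr⟩
  -- the three prescribed faces lie in the lattice
  have hback : ∀ (x : G) (X : CMF G c) (s s' : G), gface c hc2 (rt c x X) (s * x⁻¹) (s' * x⁻¹) ∈ S →
      gface c hc2 X s s' ∈ Submodule.span ℤ (pairSet c) ⊔ Submodule.span ℤ (translates c S) := by
    intro x X s s' hS'
    have hS'' : gface c hc2 (rt c x X) (s * x⁻¹) (s' * x⁻¹) ∈ translates c S :=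
      ⟨1, _, hS', by rw [show rt c (1 : G) = id from funext (rt_one c), Finsupp.mapDomain_id]⟩
    have e := hLrt x⁻¹ _ (Submodule.mem_sup_right (Submodule.subset_span hS''))
    rwa [mapDomain_rt_gface, rt_inv_rt, inv_inv, inv_mul_cancel_right, inv_mul_cancel_right] at e
  have hF : gface c hc2 Φ k h ∈ Submodule.span ℤ (pairSet c) ⊔ Submodule.span ℤ (translates c S) := by
    have h2 : 2 ≤ bpot c T₀ (blk c Φ).out := by rw [bpot_out, hb4]; omega
    have hS' := hmem (blk c Φ) h2
    rw [hτ₀, ← hg] at hS'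
    have e := hback g Φ k (c * h) hS'
    have e2 : gface c hc2 Φ k (c * h) = gface c hc2 Φ k h := by unfold gface; simp only [oflipCM_cmul]
    rwa [e2] at e
  have hFk : gface c hc2 (oflipCM c hc2 k Φ) h h'' ∈ Submodule.span ℤ (pairSet c) ⊔ Submodule.span ℤ (translates c S) := by
    have h2 : 2 ≤ bpot c T₀ (blk c (oflipCM c hc2 k Φ)).out := by rw [bpot_out, hbpk]; omega
    have hS' := hmem _ h2
    rw [hτB₁, ← hg'] at hS'
    have e := hback g' _ (c * h) (c * h'') hS'
    have e2 : gface c hc2 (oflipCM c hc2 k Φ) (c * h) (c * h'') = gface c hc2 (oflipCM c hc2 k Φ) h h'' := by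
      unfold gface; simp only [oflipCM_cmul]
    rwa [e2] at e
  have hFh : gface c hc2 (oflipCM c hc2 h Φ) (h * g₁⁻¹) κ₂ ∈ Submodule.span ℤ (pairSet c) ⊔ Submodule.span ℤ (translates c S) := by
    have h2 : 2 ≤ bpot c T₀ (blk c (oflipCM c hc2 h Φ)).out := by rw [bpot_out, hbph']; omega
    have hS' := hmem _ h2
    rw [hτB₂, ← hg''] at hS'
    have e := hback g'' _ (h * g₁⁻¹ * c⁻¹) (κ₂ * c⁻¹) hS'
    have e2 : gface c hc2 (oflipCM c hc2 h Φ) (h * g₁⁻¹ * c⁻¹) (κ₂ * c⁻¹) = gface c hc2 (oflipCM c hc2 h Φ) (h * g₁⁻¹) κ₂ := by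
      rw [hcinv, hcen (h * g₁⁻¹), hcen κ₂]; unfold gface; simp only [oflipCM_cmul]
    rwa [e2] at e
  exact residual_closure_order_four c hc2 hcen T₀ T₁ hbase m hn hH Q hQ hQ₁ hσH _ hLrt hcover hc1 hP hm T A hTH hA hT hAtr hTe ht₁₂ Φ hΦ hAe hkk''
    hHe hhh'' g₁ hg₀ hg₁ hgΦ hAce hκ₁₂ ha₁A ha₂A ha₁₂ hζh hζκ hσh hσh'' hσκ₁ hσκ₂ hF hFk hFh

end Frame

end

end Summit.HodgeConjecture.CorCM.Census.CentralSquares
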